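import Summits.BirchSwinnertonDyer.BirchSwinnertonDyer.Theorems.CongruentShaFreeCutRungMonsky

/-! # Route `CongruentShaFreeCut` (rung S2) — registered stub `stub_rung_monskyUncovered` of crux
`RankPosOfTwoSelmerCorankOne` (stmt-BirchSwinnertonDyer-19079, the route's declared RESIDUAL conjunct)

STUB CREDIT ALIAS (3 lines). The theorem `CongruentShaFreeCutRungMonsky.rung_monskyUncovered`
(p418006, prover bsd-cn100-transfer-2) is crux A VERBATIM restricted to the Monsky-uncovered family
`W = {2pq : p ≡ 3, q ≡ 5 (mod 8) ∨ p ≡ 5, q ≡ 7 (mod 8), (p/q) = −1}` modulo the ONE refereed fact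
`Monsky1990.cor515_rank_eq_one_and_card_selmerGroup_two` (Monsky, Math. Z. 204 (1990) Cor. 5.15 +
Remark (2)) — the BC5 SEPARATING witness for crux A (referee ledger GAP-LEDGER-read2-monsky-g29 §B,
VERDICT Part IX-D §4(a)). This file restates it under the REGISTERED stub name with the registered
signature (planner bsd-cn100-plan g10, `ledger workitem stub-add stmt-BirchSwinnertonDyer-19079
--name stub_rung_monskyUncovered …`), so that the landing is recorded as a proved stub of the crux's
skeleton (as `stub_rung_supersingular` was for crux B, p410927). Nothing new is asserted. -/

namespace Summit.BirchSwinnertonDyer.BirchSwinnertonDyer.Theorems.CongruentShaFreeCutRungMonskyStub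

open Literature.NumberTheory.EllipticCurves

/-- **stub_rung_monskyUncovered** (BC5 rung of crux A = `RankPosOfTwoSelmerCorankOne`, LANDED form):
for primes `p ≡ 3, q ≡ 5 (mod 8)` or `p ≡ 5, q ≡ 7 (mod 8)` with `(p/q) = −1` and
`corank_{ℤ₂} Sel_{2^∞}(E_{2pq}/ℚ) = 1`, the curve `E_{2pq} : y² = x³ − (2pq)²x` has a rational point of
infinite order — granted Monsky 1990 Cor. 5.15 (`hM`). Proof: `CongruentShaFreeCutRungMonsky.rung_monskyUncovered`. -/
theorem stub_rung_monskyUncovered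
    (hM : Monsky1990.cor515_rank_eq_one_and_card_selmerGroup_two) :
    ∀ ⦃p q : ℕ⦄, p.Prime → q.Prime → (p % 8 = 3 ∧ q % 8 = 5 ∨ p % 8 = 5 ∧ q % 8 = 7) →
      jacobiSym p q = -1 →
        (congruentNumberCurve (2 * (p * q))).selmerCorank 2 = 1 →
          1 ≤ (congruentNumberCurve (2 * (p * q))).mordellWeilRank :=
  CongruentShaFreeCutRungMonsky.rung_monskyUncovered hM

end Summit.BirchSwinnertonDyer.BirchSwinnertonDyer.Theorems.CongruentShaFreeCutRungMonskyStub
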